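import Mathlib
import Literature.Probability.MarkovChains.MetropolisHastings
import Literature.Probability.MarkovChains.TotalVariation
import Literature.Probability.Entropy.BinaryRelativeEntropy
import Literature.InformationTheory.Entropy.GibbsInequality
import Summits.Ventures.LatticeQCDFlow.Exactness.FlowMCMC
import Summits.Ventures.LatticeQCDFlow.Exactness.JarzynskiFinite
import Summits.Ventures.LatticeQCDFlow.Scaling.ImportanceWeights
import Summits.Ventures.LatticeQCDFlow.Scaling.SectorBudget
import Summits.Ventures.LatticeQCDFlow.Scaling.BlockDefect
import Summits.Ventures.LatticeQCDFlow.Scaling.StochasticFlows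
import Summits.Ventures.LatticeQCDFlow.Scaling.StochasticBudgets

/-!
# LatticeQCDFlow / Scaling — variance laws I: the reweighting window (T2-AA) and the Jeffreys
# identity (T2-AD)

HONEST FRAMING: exact (Metropolis-corrected) sampling algorithms for lattice gauge theory;
figures of merit are autocorrelation/cost numbers at stated couplings and volumes; no
continuum-physics claim.

Venture `LatticeQCDFlow` (cell pub-lqcd), topic `Scaling`, THEORY-2.md §3.7 / §4 T2-AA, T2-AD
(v1.7), prepared for landing by the theory seat (FANOUT row 29) from `HOME/THEORY-2-Sketch.lean`
v1.8, rebased on the tree's `Exactness/{FlowMCMC, JarzynskiFinite}` and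
`Scaling/{ImportanceWeights, SectorBudget, BlockDefect, StochasticFlows, StochasticBudgets}`
(`essFrac_eq_sq_div`, `klFin_nonneg`); split for landing (row 31) into this file and
`Scaling/AnnealingStepLaw.lean` (the Gibbs-law / annealing corollaries T2-AC, T2-AE).  All laws are
about SECOND moments of the log-weight `ℓ = log w = log(p/q)` on a finite state space:

* `varLaw`, its pair and centred representations, `chebyshev_set` (Chebyshev for a finite law),
  `one_add_sum_le_prod_one_add`;
* **T2-AA** `varLaw_logW_le_chiSq`: `Var_p(ℓ) ≤ χ²(p‖q) = 1/ESS − 1`, i.e. the reweighting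
  ESS is at most `1/(1 + Var_p log w)` (`essFrac_le_inv_one_add_varLaw`); conversely
  `chiSq_le_exp_mul_varLaw`: `χ² ≤ e^{M}·Var_p(ℓ)` when `ℓ` oscillates by at most `M`
  (both from the symmetric pair sum `chiSq_eq_half_sum` and `t² ≤ e^t + e^{−t} − 2 ≤ e^{M} t²`);
  the Gibbs-law form (`ESS(p_U, p_V) ≤ 1/(1 + Var_{p_U}(V − U))`, the Ferrenberg–Swendsen
  REWEIGHTING WINDOW `|Δβ| ≲ 1/√(Var A) ∝ V^{−1/2}`) is `ess_step_le` in `Scaling/AnnealingStepLaw.lean`.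
* **T2-AD** (Jeffreys identity; `klFin_add_klFin`): `D(p‖q) + D(q‖p) = Σ (p − q) ℓ`.

Elementary (`[folklore]`-level); farm `lean check` rc 0, no `sorry`.
-/
namespace Summit.Ventures.LatticeQCDFlow.Theory2

open Finset
open Literature.Probability.MarkovChains
open Summit.Ventures.LatticeQCDFlow.Exactness

variable {X : Type*} [Fintype X]

/-- ESS is positive for a normalised target against a positive model. -/
theorem essFrac_pos {r q : X → ℝ} (hq : ∀ x, 0 < q x) (hr1 : ∑ x, r x = 1) :
    0 < essFrac r q := by
  rw [essFrac_eq_sq_div (fun x => (hq x).ne'), hr1, one_pow]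
  refine div_pos one_pos ?_
  obtain ⟨x, -, hx⟩ := exists_lt_of_sum_lt (s := univ) (f := fun _ => (0:ℝ)) (g := r)
    (by rw [sum_const_zero, hr1]; exact one_pos)
  exact sum_pos' (fun y _ => div_nonneg (sq_nonneg _) (hq y).le)
    ⟨x, mem_univ _, div_pos (pow_pos hx 2) (hq x)⟩


section Variance

/-- Variance of `f` under the law `p`: `E_p f² − (E_p f)²`. -/
noncomputable def varLaw (p : X → ℝ) (f : X → ℝ) : ℝ :=
  ∑ x, p x * f x ^ 2 - (∑ x, p x * f x) ^ 2

/-- Pair representation `Var_p f = ½ Σ_{x,y} p x · p y · (f x − f y)²` (`Σ p = 1`). [folklore] -/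
theorem varLaw_eq_half_sum {p : X → ℝ} (hp1 : ∑ x, p x = 1) (f : X → ℝ) :
    varLaw p f = (1 / 2) * ∑ x, ∑ y, p x * p y * (f x - f y) ^ 2 := by
  have h : ∀ x y, p x * p y * (f x - f y) ^ 2 =
      (p x * f x ^ 2) * p y + p x * (p y * f y ^ 2) - 2 * ((p x * f x) * (p y * f y)) :=
    fun x y => by ring
  simp_rw [h]
  simp only [sum_add_distrib, sum_sub_distrib, ← mul_sum, ← sum_mul, hp1]
  unfold varLaw
  ring

/-- Centred representation `Var_p f = Σ p (f − E_p f)²` (`Σ p = 1`). [folklore] -/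
theorem varLaw_eq_sum_sq_dev {p : X → ℝ} (hp1 : ∑ x, p x = 1) (f : X → ℝ) :
    varLaw p f = ∑ x, p x * (f x - ∑ y, p y * f y) ^ 2 := by
  have h : ∀ x, p x * (f x - ∑ y, p y * f y) ^ 2 =
      p x * f x ^ 2 - (2 * ∑ y, p y * f y) * (p x * f x) + (∑ y, p y * f y) ^ 2 * p x :=
    fun x => by ring
  simp_rw [h]
  simp only [sum_add_distrib, sum_sub_distrib, ← mul_sum, hp1]
  unfold varLaw
  ring

/-- Variance is non-negative (for a non-negative normalised law). -/
theorem varLaw_nonneg {p : X → ℝ} (hp : ∀ x, 0 ≤ p x) (hp1 : ∑ x, p x = 1) (f : X → ℝ) :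
    0 ≤ varLaw p f := by
  rw [varLaw_eq_half_sum hp1]
  exact mul_nonneg (by norm_num) (sum_nonneg fun x _ => sum_nonneg fun y _ =>
    mul_nonneg (mul_nonneg (hp x) (hp y)) (sq_nonneg _))

/-- Variance depends on `f` only through its pair differences (shift / sign invariance). -/
theorem varLaw_congr_pair {p : X → ℝ} (hp1 : ∑ x, p x = 1) {f g : X → ℝ}
    (h : ∀ x y, (g x - g y) ^ 2 = (f x - f y) ^ 2) : varLaw p g = varLaw p f := by
  rw [varLaw_eq_half_sum hp1, varLaw_eq_half_sum hp1]
  simp_rw [h]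

/-- Scaling: `Var_p(c f) = c² Var_p f`. -/
theorem varLaw_const_mul {p : X → ℝ} (hp1 : ∑ x, p x = 1) (c : ℝ) (f : X → ℝ) :
    varLaw p (fun x => c * f x) = c ^ 2 * varLaw p f := by
  rw [varLaw_eq_half_sum hp1, varLaw_eq_half_sum hp1]
  have h : ∀ x y, p x * p y * (c * f x - c * f y) ^ 2 =
      c ^ 2 * (p x * p y * (f x - f y) ^ 2) := fun x y => by ring
  simp_rw [h, ← mul_sum]
  ring

/-- **Chebyshev's inequality** for a finite law: an event on which `|f − E_p f| ≥ s` has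
`p`-mass at most `Var_p f / s²`. [folklore] -/
theorem chebyshev_set {p : X → ℝ} (hp : ∀ x, 0 ≤ p x) (hp1 : ∑ x, p x = 1) (f : X → ℝ)
    {s : ℝ} (hs : 0 < s) (E : Finset X) (hE : ∀ x ∈ E, s ≤ |f x - ∑ y, p y * f y|) :
    ∑ x ∈ E, p x ≤ varLaw p f / s ^ 2 := by
  rw [varLaw_eq_sum_sq_dev hp1, le_div_iff₀ (pow_pos hs 2), sum_mul]
  calc ∑ x ∈ E, p x * s ^ 2
      ≤ ∑ x ∈ E, p x * (f x - ∑ y, p y * f y) ^ 2 := by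
        refine sum_le_sum fun x hx => mul_le_mul_of_nonneg_left ?_ (hp x)
        calc s ^ 2 ≤ |f x - ∑ y, p y * f y| ^ 2 := pow_le_pow_left₀ hs.le (hE x hx) 2
          _ = (f x - ∑ y, p y * f y) ^ 2 := sq_abs _
    _ ≤ ∑ x, p x * (f x - ∑ y, p y * f y) ^ 2 :=
        sum_le_sum_of_subset_of_nonneg (subset_univ E) fun x _ _ =>
          mul_nonneg (hp x) (sq_nonneg _)

/-- `1 + Σ aᵢ ≤ Π (1 + aᵢ)` for `aᵢ ≥ 0`. [folklore] -/
theorem one_add_sum_le_prod_one_add {ι : Type*} (s : Finset ι) {a : ι → ℝ}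
    (ha : ∀ i ∈ s, 0 ≤ a i) : 1 + ∑ i ∈ s, a i ≤ ∏ i ∈ s, (1 + a i) := by
  induction s using Finset.cons_induction with
  | empty => simp
  | cons i s hi ih =>
    rw [Finset.sum_cons, Finset.prod_cons]
    have ha' : ∀ j ∈ s, 0 ≤ a j := fun j hj => ha j (Finset.mem_cons.mpr (Or.inr hj))
    have hi0 : 0 ≤ a i := ha i (Finset.mem_cons_self i s)
    have hT : 0 ≤ ∑ j ∈ s, a j := sum_nonneg ha'
    have hih := ih ha'
    nlinarith [mul_nonneg hi0 (sub_nonneg.mpr hih), mul_nonneg hi0 hT]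

end Variance

/-! ### T2-AA: the log-weight variance under the target is at most χ² -/

section ChiSqVariance

/-- Log importance weight `ℓ = log w = log(p/q)`; `D(p‖q) = E_p ℓ` (`klFin`). -/
noncomputable def logW (p q : X → ℝ) (x : X) : ℝ := Real.log (p x / q x)

omit [Fintype X] in
/-- `b * (a / b) = a` for `b ≠ 0` (plumbing). -/
private theorem mul_div_cancel_pos {a b : ℝ} (hb : b ≠ 0) : b * (a / b) = a := by
  rw [← mul_div_assoc, mul_div_cancel_left₀ a hb]

omit [Fintype X] in
/-- `t² ≤ e^t + e^{−t} − 2` (`= 4 sinh²(t/2) ≥ 4(t/2)²`). [folklore] -/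
theorem sq_le_exp_add_exp_neg_sub_two (t : ℝ) :
    t ^ 2 ≤ Real.exp t + Real.exp (-t) - 2 := by
  have hs : (t / 2) ^ 2 ≤ Real.sinh (t / 2) ^ 2 := by
    have h1 : |t / 2| ≤ |Real.sinh (t / 2)| := by
      rw [Real.abs_sinh]
      exact Real.self_le_sinh_iff.mpr (abs_nonneg _)
    exact sq_le_sq.mpr h1
  have e1 : Real.exp t = Real.exp (t / 2) ^ 2 := by
    rw [sq, ← Real.exp_add]; congr 1; ring
  have e2 : Real.exp (-t) = Real.exp (-(t / 2)) ^ 2 := by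
    rw [sq, ← Real.exp_add]; congr 1; ring
  have e3 : Real.exp (t / 2) * Real.exp (-(t / 2)) = 1 := by
    rw [← Real.exp_add, add_neg_cancel, Real.exp_zero]
  have key : Real.exp t + Real.exp (-t) - 2 = 4 * Real.sinh (t / 2) ^ 2 := by
    rw [Real.sinh_eq, e1, e2]
    linear_combination (2 : ℝ) * e3
  have h4 : t ^ 2 = 4 * (t / 2) ^ 2 := by ring
  rw [key, h4]
  exact mul_le_mul_of_nonneg_left hs (by norm_num)

omit [Fintype X] in
/-- `e^t + e^{−t} − 2 ≤ t²·e^{|t|}`. [folklore] -/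
theorem exp_add_exp_neg_sub_two_le (t : ℝ) :
    Real.exp t + Real.exp (-t) - 2 ≤ t ^ 2 * Real.exp |t| := by
  have main : ∀ u : ℝ, 0 ≤ u → Real.exp u + Real.exp (-u) - 2 ≤ u ^ 2 * Real.exp u := by
    intro u hu
    have e1 : Real.exp u = Real.exp (u / 2) ^ 2 := by
      rw [sq, ← Real.exp_add]; congr 1; ring
    have e2 : Real.exp (-u) = Real.exp (-(u / 2)) ^ 2 := by
      rw [sq, ← Real.exp_add]; congr 1; ring
    have e3 : Real.exp (u / 2) * Real.exp (-(u / 2)) = 1 := by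
      rw [← Real.exp_add, add_neg_cancel, Real.exp_zero]
    have hA := Real.add_one_le_exp (-(u / 2))
    have ha_pos : 0 < Real.exp (u / 2) := Real.exp_pos _
    have ha1 : 1 ≤ Real.exp (u / 2) := Real.one_le_exp (by linarith)
    have hb1 : Real.exp (-(u / 2)) ≤ 1 := Real.exp_le_one_iff.mpr (by linarith)
    have p1 : Real.exp (u / 2) * (-(u / 2) + 1) ≤ Real.exp (u / 2) * Real.exp (-(u / 2)) :=
      mul_le_mul_of_nonneg_left hA ha_pos.le
    rw [e3] at p1
    have p2 : 0 ≤ u * (Real.exp (u / 2) - 1) := mul_nonneg hu (by linarith)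
    have hsub : Real.exp (u / 2) - Real.exp (-(u / 2)) ≤ u * Real.exp (u / 2) := by
      nlinarith [p1, p2, hA]
    have h0 : 0 ≤ Real.exp (u / 2) - Real.exp (-(u / 2)) := by linarith
    have hsq : (Real.exp (u / 2) - Real.exp (-(u / 2))) ^ 2 ≤ (u * Real.exp (u / 2)) ^ 2 :=
      pow_le_pow_left₀ h0 hsub 2
    calc Real.exp u + Real.exp (-u) - 2 = (Real.exp (u / 2) - Real.exp (-(u / 2))) ^ 2 := by
          rw [e1, e2]; linear_combination (2 : ℝ) * e3
      _ ≤ (u * Real.exp (u / 2)) ^ 2 := hsq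
      _ = u ^ 2 * Real.exp u := by rw [mul_pow, e1]
  rcases le_total 0 t with ht | ht
  · rw [abs_of_nonneg ht]; exact main t ht
  · rw [abs_of_nonpos ht]
    have h := main (-t) (by linarith)
    rw [neg_neg] at h
    have e : (-t) ^ 2 = t ^ 2 := by ring
    rw [e] at h
    linarith

/-- **χ² as a symmetric pair sum.**  `1/ESS − 1 = ½ Σ_{x,y} p x p y (e^{ℓx−ℓy} + e^{ℓy−ℓx} − 2)`.
[folklore] -/
theorem chiSq_eq_half_sum {p q : X → ℝ} (hp : ∀ x, 0 < p x) (hq : ∀ x, 0 < q x)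
    (hp1 : ∑ x, p x = 1) (hq1 : ∑ x, q x = 1) :
    (essFrac p q)⁻¹ - 1 = (1 / 2) * ∑ x, ∑ y, p x * p y *
      (Real.exp (logW p q x - logW p q y) + Real.exp (logW p q y - logW p q x) - 2) := by
  rw [essFrac_eq_inv hq hp1, inv_inv]
  have hw : ∀ x, Real.exp (logW p q x) = p x / q x :=
    fun x => Real.exp_log (div_pos (hp x) (hq x))
  have hterm : ∀ x y, p x * p y * Real.exp (logW p q x - logW p q y) =
      (p x * weight p q x) * q y := by
    intro x y
    rw [sub_eq_add_neg, Real.exp_add, Real.exp_neg, hw, hw, inv_div]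
    rw [show p x * p y * (p x / q x * (q y / p y)) = (p x * (p x / q x)) * (p y * (q y / p y))
        by ring, mul_div_cancel_pos (hp y).ne', weight]
  have hxy : ∀ x y, p x * p y *
      (Real.exp (logW p q x - logW p q y) + Real.exp (logW p q y - logW p q x) - 2)
      = (p x * weight p q x) * q y + q x * (p y * weight p q y) - 2 * (p x * p y) := by
    intro x y
    have a := hterm x y
    have b := hterm y x
    calc p x * p y *
          (Real.exp (logW p q x - logW p q y) + Real.exp (logW p q y - logW p q x) - 2)
        = p x * p y * Real.exp (logW p q x - logW p q y)
          + p y * p x * Real.exp (logW p q y - logW p q x) - 2 * (p x * p y) := by ring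
      _ = (p x * weight p q x) * q y + q x * (p y * weight p q y) - 2 * (p x * p y) := by
          rw [a, b]; ring
  simp_rw [hxy]
  simp only [sum_add_distrib, sum_sub_distrib, ← mul_sum, ← sum_mul, hp1, hq1]
  ring

/-- **T2-AA (variance law; proved).**  `Var_p(log w) ≤ χ²(p‖q) = 1/ESS − 1`: the reweighting
ESS is at most `1/(1 + Var_p log w)`.  (The variance under the TARGET; the variance under the
model does not bound the ESS — two-point example `q` uniform, `p = (1−ε, ε)`.) [folklore] -/
theorem varLaw_logW_le_chiSq {p q : X → ℝ} (hp : ∀ x, 0 < p x) (hq : ∀ x, 0 < q x)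
    (hp1 : ∑ x, p x = 1) (hq1 : ∑ x, q x = 1) :
    varLaw p (logW p q) ≤ (essFrac p q)⁻¹ - 1 := by
  rw [chiSq_eq_half_sum hp hq hp1 hq1, varLaw_eq_half_sum hp1]
  refine mul_le_mul_of_nonneg_left (sum_le_sum fun x _ => sum_le_sum fun y _ => ?_)
    (by norm_num)
  have h := sq_le_exp_add_exp_neg_sub_two (logW p q x - logW p q y)
  rw [neg_sub] at h
  exact mul_le_mul_of_nonneg_left h (mul_nonneg (hp x).le (hp y).le)

/-- **T2-AA (ESS form).**  `ESS(p, q) ≤ 1/(1 + Var_p(log w))`. -/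
theorem essFrac_le_inv_one_add_varLaw {p q : X → ℝ} (hp : ∀ x, 0 < p x) (hq : ∀ x, 0 < q x)
    (hp1 : ∑ x, p x = 1) (hq1 : ∑ x, q x = 1) :
    essFrac p q ≤ (1 + varLaw p (logW p q))⁻¹ := by
  have hV := varLaw_logW_le_chiSq hp hq hp1 hq1
  have hV0 : 0 ≤ varLaw p (logW p q) := varLaw_nonneg (fun x => (hp x).le) hp1 _
  have hE : 0 < essFrac p q := essFrac_pos hq hp1
  rw [le_inv_comm₀ hE (by linarith)]
  linarith

/-- **T2-AA (converse under bounded oscillation).**  If the log-weight oscillates by at most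
`M` (`|ℓ x − ℓ y| ≤ M`), then `χ²(p‖q) ≤ e^{M}·Var_p(log w)`. [folklore] -/
theorem chiSq_le_exp_mul_varLaw {p q : X → ℝ} (hp : ∀ x, 0 < p x) (hq : ∀ x, 0 < q x)
    (hp1 : ∑ x, p x = 1) (hq1 : ∑ x, q x = 1) {M : ℝ}
    (hM : ∀ x y, |logW p q x - logW p q y| ≤ M) :
    (essFrac p q)⁻¹ - 1 ≤ Real.exp M * varLaw p (logW p q) := by
  rw [chiSq_eq_half_sum hp hq hp1 hq1, varLaw_eq_half_sum hp1,
    show Real.exp M * ((1 / 2) * ∑ x, ∑ y, p x * p y * (logW p q x - logW p q y) ^ 2)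
      = (1 / 2) * (Real.exp M * ∑ x, ∑ y, p x * p y * (logW p q x - logW p q y) ^ 2) by ring]
  refine mul_le_mul_of_nonneg_left ?_ (by norm_num)
  rw [mul_sum]
  refine sum_le_sum fun x _ => ?_
  rw [mul_sum]
  refine sum_le_sum fun y _ => ?_
  have h := exp_add_exp_neg_sub_two_le (logW p q x - logW p q y)
  rw [neg_sub] at h
  have hexp : Real.exp |logW p q x - logW p q y| ≤ Real.exp M := Real.exp_le_exp.mpr (hM x y)
  have hpp : 0 ≤ p x * p y := mul_nonneg (hp x).le (hp y).le
  calc p x * p y *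
        (Real.exp (logW p q x - logW p q y) + Real.exp (logW p q y - logW p q x) - 2)
      ≤ p x * p y * ((logW p q x - logW p q y) ^ 2 * Real.exp |logW p q x - logW p q y|) :=
        mul_le_mul_of_nonneg_left h hpp
    _ ≤ p x * p y * ((logW p q x - logW p q y) ^ 2 * Real.exp M) :=
        mul_le_mul_of_nonneg_left (mul_le_mul_of_nonneg_left hexp (sq_nonneg _)) hpp
    _ = Real.exp M * (p x * p y * (logW p q x - logW p q y) ^ 2) := by ring

/-- `E_q ℓ = −D(q‖p)`. -/
theorem sum_mul_logW_eq_neg_klFin (p q : X → ℝ) :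
    ∑ y, q y * logW p q y = -klFin q p := by
  unfold klFin logW
  rw [← sum_neg_distrib]
  refine sum_congr rfl fun y _ => ?_
  rw [show q y / p y = (p y / q y)⁻¹ by rw [inv_div], Real.log_inv]
  ring

/-- **T2-AD (Jeffreys identity; proved).**  `D(p‖q) + D(q‖p) = Σ (p − q)·log(p/q)`. [folklore] -/
theorem klFin_add_klFin (p q : X → ℝ) :
    klFin p q + klFin q p = ∑ x, (p x - q x) * logW p q x := by
  have h := sum_mul_logW_eq_neg_klFin p q
  have h2 : klFin p q = ∑ x, p x * logW p q x := rfl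
  rw [h2, show klFin q p = -∑ y, q y * logW p q y by rw [h, neg_neg], ← sub_eq_add_neg,
    ← sum_sub_distrib]
  exact sum_congr rfl fun x _ => by ring

end ChiSqVariance

end Summit.Ventures.LatticeQCDFlow.Theory2
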